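import Literature.AlgebraicGeometry.Frobenioids.ArchimedeanRegionCalculus
import Literature.AlgebraicGeometry.Frobenioids.CircleOpensProofs2
import Literature.AlgebraicGeometry.Frobenioids.CircleOpensProofs4
import Mathlib.Analysis.Real.Pi.Bounds
import HarnessLib

/-!
# Frobenioids II, Lemma 3.2 (iv)/(v) quantified: the angular length of an angular region
# (infrastructure for Proposition 3.4 (viii), "angular regions never shrink")

Mochizuki, *The geometry of Frobenioids II: poly-Frobenioids*, Kyushu J. Math. **62** (2008)
401–460, §3, Lemma 3.2 (iv)(v) p. 25 and the proof of Proposition 3.4 (viii), p. 32 ll. 15–30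
[cite: MochizukiFrdII2008, Prop 3.4 (viii) p.32]: "by Lemma 3.2, (iv) [which may be interpreted as
asserting that 'angular regions never shrink'], (v), there exists an integer `N` such that given any
composite `φ_n ∘ ⋯ ∘ φ_1` of [not necessarily FSMI-!] morphisms … the cardinality of the set of `j` such
that `φ_j` is an FSMI-morphism … and non-linear is `≤ N`."

This infrastructure file (abc-iut cell, layer L1, sub-DAG `SUBDAG-FrdII-Prop34.md` rows P34-L10/L11,
seat abc-iut-w5-d092) makes the printed length argument ("`|dφ_n| = |n|`, `φ_n` multiplies lengths by
`|n|`", proof of Lemma 3.2 (iv), p. 26) QUANTITATIVE, as needed to produce the integer `N`: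

* `CircleAux.arcLen A` — the length `d - c ∈ (0, 2π]` of a [nonempty] connected open `A = exp(i·(c,d))`
  of Mathlib's `Circle` (`2π` for `A = S¹`), well defined by abc-iut-L1-t7's arc-length monotonicity
  (`CircleOpens.sub_le_sub_of_exp_image_Ioo_subset`); monotone, translation- and inversion-invariant;
  `n · arcLen A ≤ 2π` whenever `z ↦ zⁿ` (`n ≥ 2`) is injective on `A` (Lemma 3.2 (v),
  `CircleOpens.exists_pair_phi_eq`), and then `arcLen (Aⁿ) ≥ n · arcLen A`.
* `dirLen B` — the same for connected open `B ⊆ O_ℂ^×` (abc-iut-L1-t4's `normOneSubgroup ℂ`), transported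
  along the isomorphism `O_ℂ^× ≅ S¹` of `exists_unitCircleEquiv`; invariant under the Galois twists
  `z ↦ σ(z)/|σ(z)|` of Def. 3.1 (iv).
The integer potential built on `dirLen` and its behaviour along the arrows of `C₀` are in the companion
`ArchimedeanFSMIPotential.lean`.

Nothing here takes a side on anything disputed; [FrdII] §3 is classical and undisputed. No statement of
the paper is restated; these are tools (definitions + lemmas) for the discharge of Prop. 3.4 (viii).
-/

namespace Literature.AlgebraicGeometry.Frobenioids

open Set Function Topology Real
open scoped Pointwise

noncomputable section

namespace ArchFrd

/-! ### Arc length on Mathlib's `Circle` -/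

namespace CircleAux

open CircleOpens

/-- The angular length of a subset of `S¹`: for a [nonempty] connected open proper subset
`A = exp(i·(c, d))` (`0 < d - c ≤ 2π`, abc-iut-L1-t7's `exists_eq_exp_image_Ioo`) it is `d - c`; for
every other subset (in particular `A = S¹`) it is `2π`. [cite: MochizukiFrdII2008, Lem 3.2 (iv) p.25] -/
def arcLen (A : Set Circle) : ℝ :=
  open scoped Classical in
  if h : IsConnected A ∧ IsOpen A ∧ A ≠ univ then
    (exists_eq_exp_image_Ioo h.1 h.2.1 h.2.2).choose_spec.choose -
      (exists_eq_exp_image_Ioo h.1 h.2.1 h.2.2).choose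
  else 2 * π

/-- An open arc `exp(i·(c, d))` with `c < d` is connected and open. [cite: MochizukiFrdII2008, Lem 3.2 p.25] -/
theorem isConnected_isOpen_arc {c d : ℝ} (h : c < d) :
    IsConnected (Circle.exp '' Ioo c d) ∧ IsOpen (Circle.exp '' Ioo c d) :=
  ⟨isConnected_exp_image_Ioo h, isOpen_exp_image isOpen_Ioo⟩

/-- An open arc of length `≤ 2π` misses its left end point, so it is a proper subset.
[cite: MochizukiFrdII2008, Lem 3.2 p.25] -/
theorem arc_ne_univ {c d : ℝ} (hcd : d - c ≤ 2 * π) : Circle.exp '' Ioo c d ≠ univ := fun h =>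
  exp_left_notMem_exp_image_Ioo hcd (h ▸ mem_univ _)

/-- **Well-definedness**: the length of the arc `exp(i·(c, d))`, `0 < d - c ≤ 2π`, is `d - c`.
[cite: MochizukiFrdII2008, Lem 3.2 (iv) p.25] -/
theorem arcLen_arc {c d : ℝ} (h : c < d) (hcd : d - c ≤ 2 * π) :
    arcLen (Circle.exp '' Ioo c d) = d - c := by
  have hP : IsConnected (Circle.exp '' Ioo c d) ∧ IsOpen (Circle.exp '' Ioo c d) ∧
      Circle.exp '' Ioo c d ≠ univ := ⟨(isConnected_isOpen_arc h).1, (isConnected_isOpen_arc h).2,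
    arc_ne_univ hcd⟩
  unfold arcLen
  rw [dif_pos hP]
  set E := exists_eq_exp_image_Ioo hP.1 hP.2.1 hP.2.2
  obtain ⟨h₁, h₂, h₃⟩ := E.choose_spec.choose_spec
  refine le_antisymm ?_ ?_
  · exact sub_le_sub_of_exp_image_Ioo_subset h₁ hcd h₃.symm.subset
  · exact sub_le_sub_of_exp_image_Ioo_subset h h₂ h₃.subset

/-- The length of `S¹` is `2π`. [cite: MochizukiFrdII2008, Lem 3.2 (iv) p.25] -/
theorem arcLen_univ : arcLen (univ : Set Circle) = 2 * π := by
  unfold arcLen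
  rw [dif_neg]
  exact fun h => h.2.2 rfl

/-- Lengths lie in `(0, 2π]`. [cite: MochizukiFrdII2008, Lem 3.2 (iv) p.25] -/
theorem arcLen_pos (A : Set Circle) : 0 < arcLen A := by
  unfold arcLen
  split_ifs with h
  · obtain ⟨h₁, -, -⟩ := (exists_eq_exp_image_Ioo h.1 h.2.1 h.2.2).choose_spec.choose_spec
    linarith
  · exact two_pi_pos

/-- Lengths lie in `(0, 2π]`. [cite: MochizukiFrdII2008, Lem 3.2 (iv) p.25] -/
theorem arcLen_le_two_pi (A : Set Circle) : arcLen A ≤ 2 * π := by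
  unfold arcLen
  split_ifs with h
  · obtain ⟨-, h₂, -⟩ := (exists_eq_exp_image_Ioo h.1 h.2.1 h.2.2).choose_spec.choose_spec
    exact h₂
  · exact le_rfl

/-- **Monotonicity, arc form**: an arc of length `d - c ≤ 2π` inside a connected open `A` has length at
most `arcLen A`. [cite: MochizukiFrdII2008, Lem 3.2 (iv) p.25] -/
theorem sub_le_arcLen {c d : ℝ} (h : c < d) (hcd : d - c ≤ 2 * π) {A : Set Circle}
    (hA : IsConnected A) (hAo : IsOpen A) (hsub : Circle.exp '' Ioo c d ⊆ A) : d - c ≤ arcLen A := by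
  by_cases hU : A = univ
  · rw [hU, arcLen_univ]; exact hcd
  · obtain ⟨c', d', h', hcd', rfl⟩ := exists_eq_exp_image_Ioo hA hAo hU
    rw [arcLen_arc h' hcd']
    exact sub_le_sub_of_exp_image_Ioo_subset h hcd' hsub

/-- **Monotonicity** ("angular regions never shrink"): `A ⊆ A'` connected open ⇒ `arcLen A ≤ arcLen A'`.
[cite: MochizukiFrdII2008, Lem 3.2 (iv) p.25] -/
theorem arcLen_mono {A A' : Set Circle} (hA : IsConnected A) (hAo : IsOpen A) (hA' : IsConnected A')
    (hA'o : IsOpen A') (h : A ⊆ A') : arcLen A ≤ arcLen A' := by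
  by_cases hU : A = univ
  · have : A' = univ := univ_subset_iff.mp (hU ▸ h)
    rw [hU, this]
  · obtain ⟨c, d, hcd, hlen, rfl⟩ := exists_eq_exp_image_Ioo hA hAo hU
    rw [arcLen_arc hcd hlen]
    exact sub_le_arcLen hcd hlen hA' hA'o h

/-- **Translation invariance**. [cite: MochizukiFrdII2008, Lem 3.2 (iv) p.25] -/
theorem arcLen_smul {A : Set Circle} (hA : IsConnected A) (hAo : IsOpen A) (w : Circle) :
    arcLen (w • A) = arcLen A := by
  by_cases hU : A = univ
  · rw [hU, smul_set_univ]
  · obtain ⟨c, d, hcd, hlen, rfl⟩ := exists_eq_exp_image_Ioo hA hAo hU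
    obtain ⟨t, rfl⟩ := Circle.exp_surjective w
    rw [exp_smul_exp_image, image_const_add_Ioo, arcLen_arc hcd hlen,
      arcLen_arc (by linarith) (by linarith)]
    ring

/-- **Inversion invariance** (complex conjugation on `S¹`). [cite: MochizukiFrdII2008, Lem 3.2 (iv) p.25] -/
theorem arcLen_inv {A : Set Circle} (hA : IsConnected A) (hAo : IsOpen A) : arcLen A⁻¹ = arcLen A := by
  by_cases hU : A = univ
  · rw [hU, inv_univ]
  · obtain ⟨c, d, hcd, hlen, rfl⟩ := exists_eq_exp_image_Ioo hA hAo hU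
    have : (Circle.exp '' Ioo c d)⁻¹ = Circle.exp '' Ioo (-d) (-c) := by
      rw [← image_inv_eq_inv, image_image]
      have h1 : (fun x => (Circle.exp x)⁻¹) = fun x => Circle.exp (-x) := by
        funext x; rw [Circle.exp_neg]
      rw [h1, ← image_image (f := Neg.neg) (g := Circle.exp), image_neg_Ioo]
    rw [this, arcLen_arc hcd hlen, arcLen_arc (by linarith) (by linarith)]
    ring

/-- `exp(i n x) = exp(i x)ⁿ`. [cite: MochizukiFrdII2008, Lem 3.2 p.25] -/
theorem exp_nat_mul (n : ℕ) (x : ℝ) : Circle.exp (n * x) = Circle.exp x ^ n := by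
  have h := phi_exp n x
  rw [phi, zpow_natCast] at h
  exact_mod_cast h.symm

/-- The `n`-fold product set of an arc contains the `n`-times longer arc:
`exp(i·(nc, nd)) ⊆ exp(i·(c, d))ⁿ` (`x = n · (x/n)`). [cite: MochizukiFrdII2008, Lem 3.2 (iv) p.25] -/
theorem arc_mul_subset_pow (c d : ℝ) {n : ℕ} (hn : 0 < n) :
    Circle.exp '' Ioo (n * c) (n * d) ⊆ (Circle.exp '' Ioo c d) ^ n := by
  rintro _ ⟨x, hx, rfl⟩
  have hn' : (0 : ℝ) < n := by exact_mod_cast hn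
  have hx' : x / n ∈ Ioo c d := by
    constructor
    · rw [lt_div_iff₀ hn']; linarith [hx.1, mul_comm (n : ℝ) c]
    · rw [div_lt_iff₀ hn']; linarith [hx.2, mul_comm (n : ℝ) d]
  have : Circle.exp x = Circle.exp (x / n) ^ n := by
    rw [← exp_nat_mul, mul_div_cancel₀ _ hn'.ne']
  rw [this]
  exact Set.pow_mem_pow ⟨x / n, hx', rfl⟩

/-- **Lemma 3.2 (v), quantified**: if `z ↦ zⁿ` (`n ≥ 2`) is injective on a connected open `A`, then
`n · arcLen A ≤ 2π`. [cite: MochizukiFrdII2008, Lem 3.2 (v) p.25] -/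
theorem mul_arcLen_le_of_injOn {A : Set Circle} (hA : IsConnected A) (hAo : IsOpen A) {n : ℕ}
    (hn : 2 ≤ n) (hinj : InjOn (fun z : Circle => z ^ n) A) : n * arcLen A ≤ 2 * π := by
  have key : ∀ {c d : ℝ}, Circle.exp '' Ioo c d ⊆ A → ¬ 2 * π < n * (d - c) := by
    intro c d hsub hlt
    have hn1 : 1 < |((n : ℤ) : ℝ)| := by
      rw [Int.cast_natCast, abs_of_nonneg (by positivity)]; exact_mod_cast hn
    have hlt' : 2 * π < |((n : ℤ) : ℝ)| * (d - c) := by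
      rwa [Int.cast_natCast, abs_of_nonneg (by positivity)]
    obtain ⟨z₁, hz₁, z₂, hz₂, hne, heq⟩ := exists_pair_phi_eq hlt' hn1
    refine hne (hinj (hsub hz₁) (hsub hz₂) ?_)
    simpa only [phi, zpow_natCast] using heq
  by_contra hlt
  rw [not_le] at hlt
  by_cases hU : A = univ
  · -- the whole circle: use a long arc inside it
    have hsub : Circle.exp '' Ioo 0 9 ⊆ A := hU ▸ subset_univ _
    refine key hsub ?_
    have h7 : 2 * π < 9 := by linarith [pi_lt_four]
    have hn' : (2 : ℝ) ≤ n := by exact_mod_cast hn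
    nlinarith
  · obtain ⟨c, d, hcd, hlen, rfl⟩ := exists_eq_exp_image_Ioo hA hAo hU
    rw [arcLen_arc hcd hlen] at hlt
    exact key subset_rfl hlt

end CircleAux

/-! ### Angular length on `O_ℂ^×` -/

section NormOne

/-- A fixed isomorphism of topological groups `S¹ ≅ O_ℂ^×` (from `exists_unitCircleEquiv`; any two
differ by `z ↦ z^{±1}`, under which lengths are invariant). [cite: MochizukiFrdII2008, Def 3.1 (ii) p.23] -/
def ucEquiv : Circle ≃* ↥(normOneSubgroup ℂ) := exists_unitCircleEquiv.choose

/-- The homeomorphism underlying `ucEquiv`. [cite: MochizukiFrdII2008, Def 3.1 (ii) p.23] -/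
def ucHomeo : Circle ≃ₜ ↥(normOneSubgroup ℂ) := exists_unitCircleEquiv.choose_spec.choose

/-- `ucHomeo` and `ucEquiv` are the same map. [cite: MochizukiFrdII2008, Def 3.1 (ii) p.23] -/
theorem ucHomeo_apply (z : Circle) : ucHomeo z = ucEquiv z :=
  exists_unitCircleEquiv.choose_spec.choose_spec.1 z

/-- Preimages under `ucEquiv` and `ucHomeo` agree. [cite: MochizukiFrdII2008, Def 3.1 (ii) p.23] -/
theorem preimage_ucEquiv (B : Set ↥(normOneSubgroup ℂ)) : ucEquiv ⁻¹' B = ucHomeo ⁻¹' B := by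
  ext z; rw [mem_preimage, mem_preimage, ucHomeo_apply]

/-- **The angular length** of a subset `B ⊆ O_ℂ^×` (the angular part of an angular region, Def. 3.1
(iii)): the arc length of the corresponding subset of `S¹`. [cite: MochizukiFrdII2008, Lem 3.2 (iv) p.25] -/
def dirLen (B : Set ↥(normOneSubgroup ℂ)) : ℝ := CircleAux.arcLen (ucEquiv ⁻¹' B)

variable {B B' : Set ↥(normOneSubgroup ℂ)}

/-- Connected subsets of `O_ℂ^×` correspond to connected subsets of `S¹`. [cite: MochizukiFrdII2008, Def 3.1 (ii) p.23] -/
theorem pre_conn (hB : IsConnected B) : IsConnected (ucEquiv ⁻¹' B) := by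
  rw [preimage_ucEquiv]; exact ucHomeo.isConnected_preimage.2 hB

/-- Open subsets of `O_ℂ^×` correspond to open subsets of `S¹`. [cite: MochizukiFrdII2008, Def 3.1 (ii) p.23] -/
theorem pre_open (hB : IsOpen B) : IsOpen (ucEquiv ⁻¹' B) := by
  rw [preimage_ucEquiv]; exact ucHomeo.isOpen_preimage.2 hB

/-- Angular lengths are positive. [cite: MochizukiFrdII2008, Lem 3.2 (iv) p.25] -/
theorem dirLen_pos (B : Set ↥(normOneSubgroup ℂ)) : 0 < dirLen B := CircleAux.arcLen_pos _

/-- Angular lengths are at most `2π`. [cite: MochizukiFrdII2008, Lem 3.2 (iv) p.25] -/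
theorem dirLen_le_two_pi (B : Set ↥(normOneSubgroup ℂ)) : dirLen B ≤ 2 * π :=
  CircleAux.arcLen_le_two_pi _

/-- The full circle has angular length `2π` (isotropic angular regions). [cite: MochizukiFrdII2008, Lem 3.2 (iv) p.25] -/
theorem dirLen_univ : dirLen (univ : Set ↥(normOneSubgroup ℂ)) = 2 * π := by
  rw [dirLen, preimage_univ, CircleAux.arcLen_univ]

/-- **"Angular regions never shrink"** (Lemma 3.2 (iv)): `B ⊆ B'` ⇒ `dirLen B ≤ dirLen B'`.
[cite: MochizukiFrdII2008, Lem 3.2 (iv) p.25] -/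
theorem dirLen_mono (hB : IsConnected B) (hBo : IsOpen B) (hB' : IsConnected B') (hB'o : IsOpen B')
    (h : B ⊆ B') : dirLen B ≤ dirLen B' :=
  CircleAux.arcLen_mono (pre_conn hB) (pre_open hBo) (pre_conn hB') (pre_open hB'o) (preimage_mono h)

/-- Translation invariance. [cite: MochizukiFrdII2008, Lem 3.2 (iv) p.25] -/
theorem dirLen_smul (hB : IsConnected B) (hBo : IsOpen B) (w : ↥(normOneSubgroup ℂ)) :
    dirLen (w • B) = dirLen B := by
  have : ucEquiv ⁻¹' (w • B) = ucEquiv.symm w • (ucEquiv ⁻¹' B) := by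
    ext z
    rw [mem_preimage, mem_smul_set_iff_inv_smul_mem, mem_smul_set_iff_inv_smul_mem, mem_preimage,
      smul_eq_mul, smul_eq_mul, map_mul, map_inv, MulEquiv.apply_symm_apply]
  rw [dirLen, this, CircleAux.arcLen_smul (pre_conn hB) (pre_open hBo), dirLen]

/-- Inversion invariance. [cite: MochizukiFrdII2008, Lem 3.2 (iv) p.25] -/
theorem dirLen_inv (hB : IsConnected B) (hBo : IsOpen B) : dirLen B⁻¹ = dirLen B := by
  have : ucEquiv ⁻¹' B⁻¹ = (ucEquiv ⁻¹' B)⁻¹ := by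
    ext z; rw [mem_preimage, mem_inv, mem_inv, mem_preimage, map_inv]
  rw [dirLen, this, CircleAux.arcLen_inv (pre_conn hB) (pre_open hBo), dirLen]

/-- Invariance under the Galois twists `z ↦ σ(z)/|σ(z)|` of Def. 3.1 (iv) (the identity or inversion,
`unitPart_galAct_coe`). [cite: MochizukiFrdII2008, Def 3.1 (iv) p.24] -/
theorem dirLen_twist (hB : IsConnected B) (hBo : IsOpen B) {L K : D0} (f : L ⟶ K) :
    dirLen ((fun z : ↥(normOneSubgroup ℂ) => unitPart ℂ (f.act (z : ℂˣ))) '' B) = dirLen B := by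
  unfold D0.Hom.act
  cases D0.Hom.twists f
  · have : (fun z : ↥(normOneSubgroup ℂ) => unitPart ℂ (D0.galAct false (z : ℂˣ))) = id := by
      funext z; rw [unitPart_galAct_coe]; rfl
    rw [this, image_id]
  · have : (fun z : ↥(normOneSubgroup ℂ) => unitPart ℂ (D0.galAct true (z : ℂˣ))) = Inv.inv := by
      funext z; rw [unitPart_galAct_coe]; rfl
    rw [this, image_inv_eq_inv, dirLen_inv hB hBo]

/-- **Lemma 3.2 (v), quantified, on `O_ℂ^×`**: if `z ↦ zⁿ` (`n ≥ 2`) is injective on a connected open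
`B`, then `n · dirLen B ≤ 2π`. [cite: MochizukiFrdII2008, Lem 3.2 (v) p.25] -/
theorem mul_dirLen_le_of_injOn (hB : IsConnected B) (hBo : IsOpen B) {n : ℕ} (hn : 2 ≤ n)
    (hinj : InjOn (fun z : ↥(normOneSubgroup ℂ) => z ^ n) B) : n * dirLen B ≤ 2 * π := by
  refine CircleAux.mul_arcLen_le_of_injOn (pre_conn hB) (pre_open hBo) hn ?_
  intro z hz w hw h
  have : ucEquiv z = ucEquiv w := hinj hz hw (by simpa only [map_pow] using congrArg ucEquiv h)
  exact ucEquiv.injective this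

/-- **Lengths multiply under powers** (proof of Lemma 3.2 (iv), p. 26: "`φ_n` multiplies lengths by
`|n|`"): if `n · dirLen B ≤ 2π` then the `n`-fold product set `Bⁿ` has length `≥ n · dirLen B`.
[cite: MochizukiFrdII2008, Lem 3.2 (iv) p.26] -/
theorem mul_dirLen_le_dirLen_pow (hB : IsConnected B) (hBo : IsOpen B) {n : ℕ} (hn : 0 < n)
    (h : n * dirLen B ≤ 2 * π) : n * dirLen B ≤ dirLen (B ^ n) := by
  obtain ⟨m, rfl⟩ : ∃ m, n = m + 1 := ⟨n - 1, by omega⟩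
  have hpre : ucEquiv ⁻¹' (B ^ (m + 1)) = (ucEquiv ⁻¹' B) ^ (m + 1) := by
    have : ucEquiv ⁻¹' B = ucEquiv.symm '' B := (ucEquiv.toEquiv.image_symm_eq_preimage B).symm
    have h' : ucEquiv ⁻¹' (B ^ (m + 1)) = ucEquiv.symm '' (B ^ (m + 1)) :=
      (ucEquiv.toEquiv.image_symm_eq_preimage _).symm
    rw [this, h', Set.image_pow]
  have hA := pre_conn hB
  have hAo := pre_open hBo
  by_cases hU : ucEquiv ⁻¹' B = univ
  · -- then `n = 1`
    have hlen : dirLen B = 2 * π := by rw [dirLen, hU, CircleAux.arcLen_univ]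
    have hm : m = 0 := by
      by_contra hm
      have : (2 : ℝ) ≤ (m + 1 : ℕ) := by exact_mod_cast (show 2 ≤ m + 1 by omega)
      rw [hlen] at h
      nlinarith [two_pi_pos]
    subst hm
    simp
  · obtain ⟨c, d, hcd, hlen, hBeq⟩ := CircleOpens.exists_eq_exp_image_Ioo hA hAo hU
    have hL : dirLen B = d - c := by rw [dirLen, hBeq, CircleAux.arcLen_arc hcd hlen]
    rw [hL] at h ⊢
    have hm' : (0 : ℝ) < (m + 1 : ℕ) := by exact_mod_cast hn
    have hsub : Circle.exp '' Ioo ((m + 1 : ℕ) * c) ((m + 1 : ℕ) * d) ⊆ ucEquiv ⁻¹' (B ^ (m + 1)) := by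
      rw [hpre, hBeq]; exact CircleAux.arc_mul_subset_pow c d hn
    have := CircleAux.sub_le_arcLen (mul_lt_mul_of_pos_left hcd hm') (by rw [← mul_sub]; exact h)
      (pre_conn (isConnected_pow hB m)) (pre_open (isOpen_pow hBo m)) hsub
    rw [dirLen]
    linarith [mul_sub ((m + 1 : ℕ) : ℝ) d c]

end NormOne

end ArchFrd

end

end Literature.AlgebraicGeometry.Frobenioids
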